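import Summits.ABC.IUTFork.Thm311Real3
import Summits.ABC.IUTFork.Thm311Dictionary
import Summits.ABC.IUTFork.Thm311DictionaryArch
import Literature.IUT.LogThetaLattice.VerticallyCoricLGP
import HarnessLib

/-!
# [IUTchIII] Theorem 3.11 (ii) — DISCHARGE of the typed (ii) in the strictified packet model, from
# Proposition 3.5 (ii) (a), (b)

Proof-only file (D-0012; abc-iut cell, D-0067 discharge wave 4, seat abc-iut-w4-d087, CONE-BOARD node
`IUTchIII:Thm3.11(ii)` = abc-iut-c312-1's NAMED PIECE «Thm3.11(ii)-strict», HOME/INBOX 2026-08-25T23:25:15Z);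
TAKES NO SIDE on [IUTchIII] Cor. 3.12. S. Mochizuki, *Inter-universal Teichmüller theory III*, kurims
manuscript (May 2020), Theorem 3.11 (ii) pp. 155–156 and (Ind3) p. 156, with Proposition 3.5 (ii) (a), (b)
pp. 104–105 [claim: Mochizuki2012, status: disputed].

**What is discharged, and in which reading (HONEST FRAMING, verbatim from the typer's hand-off).**
abc-iut-c312-1 types Thm. 3.11 (ii) for the `n`-th column as `Column.PartII C D`
(`Thm311LogKummer.lean`): (a) `KummerA`, (b) `KummerB`, (c) `KummerC`, `MutualCompat`, `(Ind3)`,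
`LogvolPrecise`. abc-iut-c312-5's vacuity audit (`Thm311Real3.lean`, `Column.partII_iff_ind3_of_coric`)
shows that in the STRICTIFIED packet model — the column `Column.ofDivisors L M (fun _ => D.Adm)
(fun _ => D.logvol) (fun _ => D.Ψ) (fun _ => D.Mmod) unitImage ballImage thetaDiv`, i.e. Kummer = identity on
the coric carriers, `KummerA/B/C` by `rfl` — the typed (ii) is EQUIVALENT to `Column.Ind3 D`, the
CONTAINMENTS of Prop. 3.5 (ii) (a), (b) ("upper semi-compatible": upper bounds only). This file proves
`(Ind3)`, hence the typed (ii), for every column whose transported unit-group images `unitImage` and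
radius-`π` balls `ballImage` ARE the images of data satisfying abc-iut-L6-t4's `Prop35ii_a` (at
`v_ℚ ∈ V^non_ℚ`) and `Prop35ii_b` (at `v_ℚ ∈ V^arc_ℚ`) (`VerticallyCoricLGP.lean`):

* §1 `Column.ind3_of_prop35ii` — (Ind3) for any column whose images are bound, at every `(j, v_ℚ)`, to
  Prop. 3.5 (ii) data: at `V^non_ℚ` by c312-1's dictionary lemma `Column.ind3_non_of_prop35ii_a`
  (`Thm311Dictionary.lean`), at `V^arc_ℚ` by its archimedean twin `Column.ind3_arc_of_prop35ii_b`
  (c312-1, `Thm311DictionaryArch.lean`, p412108: `unitImage m 0 := κ m '' U m`, `ballImage m := κ m '' B m`,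
  `unitImage (m − m') m' := κ m '' S` for the CHOSEN subset `S ⊆ B m` of `Prop35ii_b`'s clause 3 — the
  subset that "surjects, via the `m'`-th iterate of the log-link …, onto the subset of the group of units …
  on which this iterate is defined", p. 105; referee R7-C1-N1) — v1 of this file carried its own copy of
  that twin under the same name (landed in the same commit); v2 consumes the typer's;
  §2 `Column.partII_ofDivisors_of_prop35ii` — **the typed Thm. 3.11 (ii) HOLDS** for the strictified column
  (c312-5's `partII_iff_ind3_of_coric`); `LatticeSituation.partII_ofShells_of_prop35ii` — the same for the
  lattice situation `LatticeSituation.ofShells` built from any log-shell signature, with the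
  nonarchimedean integral structures the DEFINED ones `L.shellPk` and the archimedean ones the binder
  `archPk` (c312-5's `MRData.ofShells`).
* §3 `LogShells.prop35ii_a_shellPk_of_factors` — `Prop35ii_a` for c312-5's packet integral structure
  `L.shellPk j v_ℚ` (the additive subgroup of `⨂_{i ≤ j} ⊕_{v | v_ℚ} log(D⊢_v)` generated by the pure tensors
  of shell elements) is REDUCED TO THE FACTORS: per-place unit sets inside the shell subgroups and
  per-place partial log-iterates whose defined values on units lie in the shell subgroups give the
  packet-level data (unit groups `∏_{i,v} U_v`, Kummer maps = pure tensors, iterates = pure tensors of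
  the factor iterates where every component is defined) — the shape of abc-iut-L6-t4's
  `prop35ii_a_shellPacketN` (`VerticallyCoricLGPPackets.lean`, there over `ℚ_p` and `PadicLogOnUnits`),
  transposed to c312-1's `ℚ`-tensor packets. The REAL-CARRIER instance (abc-iut-c312-5's `K_v`,
  `Thm311Real.lean`; the log-link iterates on `O_v^×` defined, upper semi-commutativity proved for every
  logarithm binder, (Ind3) and the typed (ii) for the strictified real lattice situation, unconditional in
  the logarithm at `Real.analyticLogv`) is the sequel `Thm311PartIIDischargeReal.lean` (p412451:
  `Real.logStep/logIter/iterImage/iterUnits`, `Real.iterImage_succ_subset_shell`,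
  `Column.ind3_logShells_of_iterUnits`, `Real.partII_ofShells_of_iterUnits`, `Real.partII_ofShells_analyticLogv`)
  — audit finding F-d044-1 (abc-iut-w4-d044) on v1's header, which announced these under other names.

What is NOT captured (say so, per the typer): the content of (ii) beyond (Ind3)-as-containment — the
Kummer isomorphisms as non-identity maps of monoids ([IUTchII] Cor. 4.6 (iii), 4.8 (i)(ii)), the
log-volume compatibility of (a) as a statement about two different volumes — is not expressed by the
strictified typing and is therefore not discharged here; the archimedean data of §2 stay hypotheses
relative to the binder `archPk` (the one-factor model is abc-iut-L6-t4's `prop35ii_b_arcExp`,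
`VerticallyCoricLGPArch.lean`). No new definition, no new `Prop` fact; inputs: c312-1 `Thm311LogKummer` /
`Thm311Dictionary(Arch)`, c312-5 `Thm311Real*`, L6-t4 `VerticallyCoricLGP`. typed ≠ endorsed.
-/

noncomputable section

namespace Summit.ABC.IUTFork.Thm311

open Literature.IUT.LogThetaLattice Literature.IUT.LogVolume

variable {T : ThetaIndex}

/-! ## §1 (Ind3) from Proposition 3.5 (ii) (a), (b) -/

namespace Column

variable {L : LogShells T} (C : Column L) (D : MRData L)

/-- **(Ind3) of [IUTchIII] Thm. 3.11 (ii) HOLDS** (p. 156) for every column whose transported unit-group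
images and radius-`π` balls are bound, at every `(j, v_ℚ)`, to data satisfying Prop. 3.5 (ii) (a)
(`Prop35ii_a`, `v_ℚ ∈ V^non_ℚ`: unit groups `U m`, Kummer maps `κ m`, partial log-iterate pre-composites
`lam m m'`) resp. Prop. 3.5 (ii) (b) (`Prop35ii_b`, `v_ℚ ∈ V^arc_ℚ`: groupifications `G m ⊇ U m, B m`, Kummer
maps, log-iterates, domains, and the chosen surjecting subsets) relative to the integral structures
`D.shellPk` of the data (a) of the line. [claim: Mochizuki2012, status: disputed] -/
theorem ind3_of_prop35ii
    (hN : ∀ (j : T.Label) (vQ : T.VQ), T.IsNon vQ →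
      ∃ (U : ℤ → Type) (κ : ∀ m, U m → L.Packet j vQ)
        (lam : ∀ (m : ℤ) (m' : ℕ), 1 ≤ m' → U m → Option (L.Packet j vQ)),
        Prop35ii_a (D.shellPk j vQ) U κ lam ∧ (∀ m, C.unitImage m 0 j vQ = Set.range (κ m)) ∧
          ∀ (m : ℤ) (m' : ℕ) (hm : 1 ≤ m'), C.unitImage m m' j vQ = {x | ∃ u, lam m m' hm u = some x})
    (hA : ∀ (j : T.Label) (vQ : T.VQ), ¬ T.IsNon vQ →
      ∃ (G : ℤ → Type) (U B : ∀ m, Set (G m)) (κ : ∀ m, G m → L.Packet j vQ)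
        (lam : ∀ (m : ℤ) (m' : ℕ), G m → Option (G (m - m'))) (Dom : ∀ (m : ℤ) (m' : ℕ), Set (G m)),
        Prop35ii_b (D.shellPk j vQ) G U B κ lam Dom ∧ (∀ m, C.unitImage m 0 j vQ = κ m '' U m) ∧
          (∀ m, C.ballImage m j vQ = κ m '' B m) ∧
          ∀ (m : ℤ) (m' : ℕ), 1 ≤ m' → ∃ S ⊆ B m,
            {y | ∃ x ∈ S, lam m m' x = some y} = U (m - m') ∩ {y | ∃ x ∈ Dom (m - m') m', y = x} ∧
              C.unitImage (m - m') m' j vQ = κ m '' S) :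
    C.Ind3 D := by
  refine ⟨fun m m' j vQ hv => ?_, fun m j vQ hv => ?_⟩
  · obtain ⟨U, κ, lam, h, h0, hS⟩ := hN j vQ hv
    exact C.ind3_non_of_prop35ii_a D j vQ U κ lam h h0 hS m m'
  · obtain ⟨G, U, B, κ, lam, Dom, h, h0, hB, hS⟩ := hA j vQ hv
    exact C.ind3_arc_of_prop35ii_b D j vQ U B κ lam Dom h h0 hB
      (fun m₀ m' hm => (hS m₀ m' hm).imp fun S hS' => ⟨hS'.1, hS'.2.2⟩) m

/-! ## §2 Theorem 3.11 (ii) for the strictified column and lattice situation -/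

/-- **[IUTchIII] Thm. 3.11 (ii) — the TYPED (ii) `Column.PartII` HOLDS in the strictified packet model**
(pp. 155–156; abc-iut-c312-1's NAMED PIECE «Thm3.11(ii)-strict»): for the column `Column.ofDivisors` over
any log-shell signature `L` whose Frobenius-like binders are the coric data `D` of its line (Kummer =
identity on the coric carriers) and whose unit-group images / radius-`π` balls are bound to Prop. 3.5 (ii)
(a)/(b) data as in `ind3_of_prop35ii`, (ii) (a)(b)(c) hold by `rfl`, the mutual compatibility and the
final "[precisely!]" clause follow (c312-1 `partII_iff`), and (Ind3) is `ind3_of_prop35ii` — so `PartII D`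
(c312-5's `partII_iff_ind3_of_coric`). HONEST FRAMING: this is (ii) in the strictified reading; its content
beyond (Ind3)-as-containment is not captured by the typing. [claim: Mochizuki2012, status: disputed] -/
theorem partII_ofDivisors_of_prop35ii (L : LogShells T) (M : Type) [Field M] [NumberField M]
    (D : MRData L) (unitImage : ℤ → ℕ → ∀ (j : T.Label) (vQ : T.VQ), Set (L.Packet j vQ))
    (ballImage : ℤ → ∀ (j : T.Label) (vQ : T.VQ), Set (L.Packet j vQ))
    (thetaDiv : ℤ → LgpDivisor M T.lstar)
    (hN : ∀ (j : T.Label) (vQ : T.VQ), T.IsNon vQ →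
      ∃ (U : ℤ → Type) (κ : ∀ m, U m → L.Packet j vQ)
        (lam : ∀ (m : ℤ) (m' : ℕ), 1 ≤ m' → U m → Option (L.Packet j vQ)),
        Prop35ii_a (D.shellPk j vQ) U κ lam ∧ (∀ m, unitImage m 0 j vQ = Set.range (κ m)) ∧
          ∀ (m : ℤ) (m' : ℕ) (hm : 1 ≤ m'), unitImage m m' j vQ = {x | ∃ u, lam m m' hm u = some x})
    (hA : ∀ (j : T.Label) (vQ : T.VQ), ¬ T.IsNon vQ →
      ∃ (G : ℤ → Type) (U B : ∀ m, Set (G m)) (κ : ∀ m, G m → L.Packet j vQ)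
        (lam : ∀ (m : ℤ) (m' : ℕ), G m → Option (G (m - m'))) (Dom : ∀ (m : ℤ) (m' : ℕ), Set (G m)),
        Prop35ii_b (D.shellPk j vQ) G U B κ lam Dom ∧ (∀ m, unitImage m 0 j vQ = κ m '' U m) ∧
          (∀ m, ballImage m j vQ = κ m '' B m) ∧
          ∀ (m : ℤ) (m' : ℕ), 1 ≤ m' → ∃ S ⊆ B m,
            {y | ∃ x ∈ S, lam m m' x = some y} = U (m - m') ∩ {y | ∃ x ∈ Dom (m - m') m', y = x} ∧
              unitImage (m - m') m' j vQ = κ m '' S) :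
    (ofDivisors L M (fun _ => D.Adm) (fun _ => D.logvol) (fun _ => D.Ψ) (fun _ => D.Mmod) unitImage
        ballImage thetaDiv).PartII D :=
  (partII_iff_ind3_of_coric L M D unitImage ballImage thetaDiv).mpr
    (ind3_of_prop35ii _ D hN hA)

end Column

namespace LatticeSituation

section OfShells

variable (L : LogShells T) (M : Type) [Field M] [NumberField M]
  (archPk : ∀ (j : T.Label) (vQ : T.VQ), Set (L.Packet j vQ))
  (archSub : ∀ (j : T.Label) (v : T.V), Set (L.Packet j (T.over v)))
  (Adm : ∀ (j : T.Label) (vQ : T.VQ), Set (L.Packet j vQ) → Prop)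
  (logvol : ∀ (j : T.Label) (vQ : T.VQ), Set (L.Packet j vQ) → ℝ)
  (Ψ : ℤ → ∀ v : T.V, v ∈ T.Vbad → Set (L.StarPacket v))
  (act : ℤ → ∀ v : T.V, v ∈ T.Vbad → L.StarPacket v → Module.End ℚ (L.StarPacket v))
  (Mmod : ℤ → ∀ j : T.LabelStar, Set (L.GlobalPacket j.1))
  (region : ℤ → ∀ j : T.LabelStar, FinDivisor M → ∀ vQ : T.VQ, Set (L.Packet j.1 vQ))
  (unitImage₀ : ℤ → ℤ → ℕ → ∀ (j : T.Label) (vQ : T.VQ), Set (L.Packet j vQ))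
  (ballImage₀ : ℤ → ℤ → ∀ (j : T.Label) (vQ : T.VQ), Set (L.Packet j vQ))
  (thetaDiv₀ : ℤ → ℤ → LgpDivisor M T.lstar)

/-- **[IUTchIII] Thm. 3.11 (ii) for "the situation of Theorem 3.11" BUILT FROM A LOG-SHELL SIGNATURE**
(`LatticeSituation.ofShells`, strictified reading: each column's Frobenius-like binders := the coric data of
its line) — `LatticeSituation.PartII` HOLDS as soon as, for every column `n`, the unit-group images and the
radius-`π` balls are bound to Prop. 3.5 (ii) (a) data relative to the DEFINED nonarchimedean integral
structures `L.shellPk j v_ℚ` (pure tensors of shell elements, [IUTchIII] Prop. 3.2 (ii)) and to Prop. 3.5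
(ii) (b) data relative to the archimedean binder `archPk j v_ℚ` (Hermitian unit balls, p. 99).
[claim: Mochizuki2012, status: disputed] -/
theorem partII_ofShells_of_prop35ii
    (hN : ∀ (n : ℤ) (j : T.Label) (vQ : T.VQ), T.IsNon vQ →
      ∃ (U : ℤ → Type) (κ : ∀ m, U m → L.Packet j vQ)
        (lam : ∀ (m : ℤ) (m' : ℕ), 1 ≤ m' → U m → Option (L.Packet j vQ)),
        Prop35ii_a (L.shellPk j vQ : Set (L.Packet j vQ)) U κ lam ∧
          (∀ m, unitImage₀ n m 0 j vQ = Set.range (κ m)) ∧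
          ∀ (m : ℤ) (m' : ℕ) (hm : 1 ≤ m'), unitImage₀ n m m' j vQ = {x | ∃ u, lam m m' hm u = some x})
    (hA : ∀ (n : ℤ) (j : T.Label) (vQ : T.VQ), ¬ T.IsNon vQ →
      ∃ (G : ℤ → Type) (U B : ∀ m, Set (G m)) (κ : ∀ m, G m → L.Packet j vQ)
        (lam : ∀ (m : ℤ) (m' : ℕ), G m → Option (G (m - m'))) (Dom : ∀ (m : ℤ) (m' : ℕ), Set (G m)),
        Prop35ii_b (archPk j vQ) G U B κ lam Dom ∧ (∀ m, unitImage₀ n m 0 j vQ = κ m '' U m) ∧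
          (∀ m, ballImage₀ n m j vQ = κ m '' B m) ∧
          ∀ (m : ℤ) (m' : ℕ), 1 ≤ m' → ∃ S ⊆ B m,
            {y | ∃ x ∈ S, lam m m' x = some y} = U (m - m') ∩ {y | ∃ x ∈ Dom (m - m') m', y = x} ∧
              unitImage₀ n (m - m') m' j vQ = κ m '' S) :
    (ofShells L M archPk archSub Adm logvol Ψ act Mmod region (fun _ _ => Adm) (fun _ _ => logvol)
        (fun n _ => Ψ n) (fun n _ => Mmod n) unitImage₀ ballImage₀ thetaDiv₀).PartII := by
  intro n
  refine Column.partII_ofDivisors_of_prop35ii L M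
    (MRData.ofShells L archPk archSub Adm logvol (Ψ n) (act n) (Mmod n)) (unitImage₀ n) (ballImage₀ n)
    (thetaDiv₀ n) (fun j vQ hv => ?_) (fun j vQ hv => ?_)
  · rw [MRData.ofShells_shellPk_of_isNon L archPk archSub Adm logvol (Ψ n) (act n) (Mmod n) hv]
    exact hN n j vQ hv
  · rw [MRData.ofShells_shellPk_of_not_isNon L archPk archSub Adm logvol (Ψ n) (act n) (Mmod n) hv]
    exact hA n j vQ hv

end OfShells

end LatticeSituation

/-! ## §3 Proposition 3.5 (ii) (a) for the packet integral structure `L.shellPk`, reduced to the factors -/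

namespace LogShells

variable (L : LogShells T)

open Classical in
/-- **[IUTchIII] Prop. 3.5 (ii) (a) AT THE PACKET LEVEL of abc-iut-c312-1's `ℚ`-tensor packets, from the
FACTORS** (pp. 104–105; the shape of abc-iut-L6-t4's `prop35ii_a_shellPacketN`): for c312-5's packet
integral structure `I(^{S^±_{j+1}};D⊢_{v_ℚ}) = L.shellPk j v_ℚ` (generated by the pure tensors `x_0 ⊗ ⋯ ⊗ x_j`
with every `x_{i,v}` in the shell subgroup of `log(D⊢_v)`), per-place "unit" sets `Uset v ⊆` shell subgroup
("`O^× ⊆ O ⊆ I`", Rmk. 1.2.2 (i)) and per-place log-iterates `iter v m'` whose values on units in their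
domains `dom v m'` (`m' ≥ 1`) lie in the shell subgroup ("upper semi-commutativity", Rmk. 1.2.2 (iii)) give
`Prop35ii_a` data: unit groups `∏_{i ∈ S^±_{j+1}, v | v_ℚ} Uset v` (one copy per `m`), Kummer maps = pure
tensors ("the tensor product, over `|t|`, of the [relevant] Kummer isomorphisms"), `m'`-th iterate
pre-composites = pure tensors of the factor iterates where EVERY component is defined, undefined otherwise.
[claim: Mochizuki2012, status: disputed] -/
theorem prop35ii_a_shellPk_of_factors (j : T.Label) (vQ : T.VQ)
    (Uset : ∀ v : T.Fibre vQ, Set (L.carrier v.1)) (hU : ∀ v, Uset v ⊆ L.shellSubgroup v.1)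
    (iter : ∀ v : T.Fibre vQ, ℕ → L.carrier v.1 → L.carrier v.1)
    (dom : ∀ v : T.Fibre vQ, ℕ → Set (L.carrier v.1))
    (hiter : ∀ (v : T.Fibre vQ) (k : ℕ) (x : L.carrier v.1),
      x ∈ Uset v → x ∈ dom v (k + 1) → iter v (k + 1) x ∈ L.shellSubgroup v.1) :
    Prop35ii_a (X := L.Packet j vQ) (L.shellPk j vQ : Set (L.Packet j vQ))
      (fun _ : ℤ => ∀ (i : T.Caps j) (v : T.Fibre vQ), Uset v)
      (fun _ u => L.tprod j vQ fun i v => (u i v : L.carrier v.1))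
      (fun _ (m' : ℕ) _ u =>
        if ∀ (i : T.Caps j) (v : T.Fibre vQ), (u i v : L.carrier v.1) ∈ dom v m' then
          some (L.tprod j vQ fun i v => iter v m' (u i v : L.carrier v.1))
        else none) := by
  refine ⟨fun m u => ?_, fun m m' hm u x hx => ?_⟩
  · exact AddSubgroup.subset_closure ⟨fun i v => (u i v : L.carrier v.1), fun i v => hU v (u i v).2, rfl⟩
  · dsimp only at hx
    split_ifs at hx with hu
    obtain ⟨k, rfl⟩ : ∃ k, m' = k + 1 := ⟨m' - 1, by omega⟩
    rw [Option.some.injEq] at hx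
    subst hx
    exact AddSubgroup.subset_closure
      ⟨fun i v => iter v (k + 1) (u i v : L.carrier v.1),
        fun i v => hiter v k _ (u i v).2 (hu i v), rfl⟩

end LogShells

end Summit.ABC.IUTFork.Thm311

end
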